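import Summits.BirchSwinnertonDyer.BirchSwinnertonDyer.Theorems.ClassRecordThreeEulerHalvesAtThreeCartanSupplyMonomialCubic
import HarnessLib

/-!
# Crux 23422 `EulerHalvesAtThreeResidualUpperBound`, line `cartan`: at CUSPIDAL Cartan primes (`q ≡ 2 (mod 3)`) the mod-`3` condition
# `(𝓛/3𝓛)^G = 0` of a Cartan torus lattice is AUTOMATIC — it follows from the character alone

Seat `bsd-stepL-tam3-p1` g24 (prover, LINE OWNER of 23422 ∕ 19109; `--supports stmt-BirchSwinnertonDyer-23422`). Support lemma for the (F2b♭) ∕ NUM half of the line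
(`stub_cartanOnePlaceDegreeLawAtThree`): in bsd-idea-10's hom-lattice dictionary the Cartan torus lattice of nature is `𝕃 = Hom(J_X̄, E)` with the degree form, and
the one field of `CartanDegree.CartanTorusLattice` that is NOT formal for it is `noFixedVectorModThree` («the Ribet segment», tam3-p1 g22 `SUPPLY-STUB-PLAN.md` §A1(v)).
THIS FILE: for `q ≡ 2 (mod 3)` (the cuspidal primes, `q = 2` included) EVERY `ℤ[GL₂(𝔽_q)]`-lattice whose character is `cubicNewvectorChar q` has no non-zero fixed
vector mod `3` (`noFixedVectorModThree_of_cusp`). Proof: the Borel subgroup `B` has order `q(q−1)²`, prime to `3` exactly when `q ≡ 2 (3)`, and the cuspidal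
character sums to ZERO over `B` (`sum_borel_cubicNewvectorChar`: scalars `(q−1)·(q−1)`, non-scalar parabolics `(q−1)²·(−1)`, split elements `0` — cuspidality,
`W^N = 0`); by RANK-BY-TRACE (`eq_zero_of_fixed_of_sum_trace`, the averaging map `Q = Σ_{b∈B} b`, `ι ∘ Q = Σ b`, `Q ∘ ι = |B|`, `LinearMap.trace_comp_comm'`) the
`B`-fixed sublattice is `0`; a vector fixed mod `3` by `B` has `Σ_b b·v ≡ |B|·v (mod 3)` and `Σ_b b·v ∈ 𝓛^B = 0`, so `|B|·v ∈ 3𝓛`, so `v ∈ 3𝓛`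
(`exists_eq_smul_of_fixedMod`, Bézout). CONSEQUENCE for the line: at cuspidal places the dictionary needs no lattice-class input; the mod-`3` lattice-class
question («which end of the Ribet chain is `Hom(J_X̄, E)`») exists ONLY at principal-series places `q ≡ 1 (3)`, where the reduction of `W_q = Ind_B^G θ̃` has the
trivial Brauer constituent (`θ̃ ≡ 1 mod (1 − ω)`). Numerical companion: `HOME/tam3-p1/g24/CDEG3-RESULT.md` (exact Cartan-level optimal degrees: `m₀ = 3·m_C` in
every tested class without rational `3`-structure). HONEST: finite-group theory only; NUM ∕ (F2b♭) ∕ the crux are NOT proved; BSD is proved for no curve. [folklore]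
-/

set_option linter.dupNamespace false
set_option autoImplicit false

namespace Summit.BirchSwinnertonDyer.BirchSwinnertonDyer.Theorems.CartanSupply.CuspNoFixed

open Summit.BirchSwinnertonDyer.BirchSwinnertonDyer.Theorems.CartanDegree
open Summit.BirchSwinnertonDyer.BirchSwinnertonDyer.Theorems.CartanTorusCubeCut
open Summit.BirchSwinnertonDyer.BirchSwinnertonDyer.Theorems.CartanSupply.Monomial
open scoped Classical

/-! ## §1 Generic: a finite subgroup whose character sums to zero fixes no line, hence no vector mod `ℓ` when `ℓ ∤ |H|` -/

section generic

variable {G : Type*} [Group G] {d : ℕ} (ρ : Representation ℤ G (Fin d → ℤ)) (H : Subgroup G) [Fintype H]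

omit [Fintype H] in
/-- The sublattice of vectors fixed by every element of the subgroup `H`. -/
def fixedSub : Submodule ℤ (Fin d → ℤ) where
  carrier := {v | ∀ h : H, ρ (h : G) v = v}
  add_mem' := by
    intro a b ha hb h
    rw [map_add, ha h, hb h]
  zero_mem' := fun h => map_zero _
  smul_mem' := by
    intro c a ha h
    rw [map_smul, ha h]

omit [Fintype H] in
/-- PROVED: membership unfolding. [folklore] -/
theorem mem_fixedSub_iff (v : Fin d → ℤ) : v ∈ fixedSub ρ H ↔ ∀ h : H, ρ (h : G) v = v := Iff.rfl

/-- PROVED: the average `Σ_{h ∈ H} h·v` is `H`-fixed. [folklore] -/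
theorem sum_mem_fixedSub (v : Fin d → ℤ) : (∑ h : H, ρ (h : G) v) ∈ fixedSub ρ H := by
  intro t
  rw [map_sum]
  have hmul : ∀ h : H, ρ (t : G) (ρ (h : G) v) = ρ ((t * h : H) : G) v := by
    intro h
    rw [← Module.End.mul_apply, ← map_mul]
    rfl
  simp only [hmul]
  exact Fintype.sum_equiv (Equiv.mulLeft t) _ _ (fun s => rfl)

/-- PROVED — RANK BY TRACE: if `Σ_{h ∈ H} tr ρ(h) = 0` then the `H`-fixed sublattice is `0`. [folklore] -/
theorem eq_zero_of_fixed_of_sum_trace (hsum : ∑ h : H, LinearMap.trace ℤ (Fin d → ℤ) (ρ (h : G)) = 0) :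
    ∀ v ∈ fixedSub ρ H, v = 0 := by
  obtain ⟨n, bF⟩ := Submodule.basisOfPid (Pi.basisFun ℤ (Fin d)) (fixedSub ρ H)
  haveI := Module.Free.of_basis bF
  haveI := Module.Finite.of_basis bF
  let Q : (Fin d → ℤ) →ₗ[ℤ] fixedSub ρ H :=
    { toFun := fun v => ⟨∑ h : H, ρ (h : G) v, sum_mem_fixedSub ρ H v⟩
      map_add' := by
        intro x y
        apply Subtype.ext
        simp only [Submodule.coe_add, map_add, Finset.sum_add_distrib]
      map_smul' := by
        intro c x
        apply Subtype.ext
        simp only [Submodule.coe_smul, map_smul, Finset.smul_sum, RingHom.id_apply] }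
  let ι : fixedSub ρ H →ₗ[ℤ] (Fin d → ℤ) := (fixedSub ρ H).subtype
  -- (1) `ι ∘ Q = Σ_h ρ h`
  have h1 : ι ∘ₗ Q = ∑ h : H, ρ (h : G) := by
    apply LinearMap.ext
    intro x
    rw [LinearMap.sum_apply]
    rfl
  -- (2) its trace is `0`
  have h2 : LinearMap.trace ℤ (Fin d → ℤ) (ι ∘ₗ Q) = 0 := by
    rw [h1, map_sum, hsum]
  -- (3) `Q ∘ ι = |H| • id`
  have h3 : Q ∘ₗ ι = (Fintype.card H : ℤ) • LinearMap.id := by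
    apply LinearMap.ext
    intro y
    apply Subtype.ext
    have hy : ∀ h : H, ρ (h : G) (y : Fin d → ℤ) = y := fun h => y.2 h
    show (∑ h : H, ρ (h : G) (y : Fin d → ℤ)) = (((Fintype.card H : ℤ) • y : fixedSub ρ H) : Fin d → ℤ)
    simp only [hy, Finset.sum_const, Finset.card_univ, Submodule.coe_smul]
    rw [← natCast_zsmul]
  -- (4) `0 = |H| · rank F`
  have h4 : (0 : ℤ) = (Fintype.card H : ℤ) * Module.finrank ℤ (fixedSub ρ H) := by
    have h := LinearMap.trace_comp_comm' Q ι
    rw [h2, h3, map_smul, LinearMap.trace_id, smul_eq_mul] at h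
    exact h
  have hH : (Fintype.card H : ℤ) ≠ 0 := by exact_mod_cast Fintype.card_ne_zero
  have hrank : Module.finrank ℤ (fixedSub ρ H) = 0 := by
    rcases mul_eq_zero.1 h4.symm with h | h
    · exact absurd h hH
    · exact_mod_cast h
  have hn : n = 0 := by
    have h := Module.finrank_eq_card_basis bF
    rw [hrank, Fintype.card_fin] at h
    exact h.symm
  subst hn
  intro v hv
  have h := bF.sum_repr ⟨v, hv⟩
  rw [Finset.univ_eq_empty, Finset.sum_empty] at h
  have h' := congrArg Subtype.val h
  exact h'.symm

/-- PROVED: a vector fixed MODULO `ℓ` by `H` has `|H|·v ∈ ℓ𝓛` once the `H`-fixed sublattice is `0`. [folklore] -/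
theorem card_smul_mem_of_fixedMod (hsum : ∑ h : H, LinearMap.trace ℤ (Fin d → ℤ) (ρ (h : G)) = 0) (ℓ : ℤ) (v : Fin d → ℤ)
    (hv : ∀ h : H, ∃ w : Fin d → ℤ, ρ (h : G) v - v = ℓ • w) : ∃ w : Fin d → ℤ, (Fintype.card H : ℤ) • v = ℓ • w := by
  choose w hw using hv
  have hfix := eq_zero_of_fixed_of_sum_trace ρ H hsum _ (sum_mem_fixedSub ρ H v)
  have hrw : ∀ h : H, ρ (h : G) v = v + ℓ • w h := fun h => by rw [← hw h]; abel
  simp only [hrw, Finset.sum_add_distrib, Finset.sum_const, Finset.card_univ, ← Finset.smul_sum] at hfix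
  refine ⟨-(∑ h : H, w h), ?_⟩
  rw [smul_neg]
  rw [← natCast_zsmul] at hfix
  exact eq_neg_of_add_eq_zero_left hfix

/-- PROVED: … hence `v ∈ ℓ𝓛` when `gcd(|H|, ℓ) = 1` (Bézout). [folklore] -/
theorem exists_eq_smul_of_fixedMod (hsum : ∑ h : H, LinearMap.trace ℤ (Fin d → ℤ) (ρ (h : G)) = 0) (ℓ : ℤ)
    (hcop : IsCoprime (Fintype.card H : ℤ) ℓ) (v : Fin d → ℤ) (hv : ∀ h : H, ∃ w : Fin d → ℤ, ρ (h : G) v - v = ℓ • w) :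
    ∃ w : Fin d → ℤ, v = ℓ • w := by
  obtain ⟨w, hw⟩ := card_smul_mem_of_fixedMod ρ H hsum ℓ v hv
  obtain ⟨a, b, hab⟩ := hcop
  refine ⟨a • w + b • v, ?_⟩
  calc v = (1 : ℤ) • v := (one_smul ℤ v).symm
    _ = (a * (Fintype.card H : ℤ) + b * ℓ) • v := by rw [hab]
    _ = a • ((Fintype.card H : ℤ) • v) + (b * ℓ) • v := by rw [add_smul, mul_smul]
    _ = a • (ℓ • w) + (b * ℓ) • v := by rw [hw]
    _ = ℓ • (a • w + b • v) := by rw [smul_add, smul_comm a ℓ w, mul_comm b ℓ, mul_smul]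

end generic

/-! ## §2 `GL₂(𝔽_q)`, `q ≡ 2 (mod 3)`: the cuspidal character sums to zero over the Borel subgroup, whose order is prime to `3` -/

section borel

variable {q : ℕ} [Fact q.Prime]

/-- PROVED: the cuspidal (`q % 3 ≠ 1`) character on an upper-triangular element: `q − 1` on scalars, `−1` on non-scalar parabolics, `0` on split elements.
[folklore] -/
theorem cubicNewvectorChar_upperGL_cusp (h1 : q % 3 ≠ 1) (a d : (ZMod q)ˣ) (b : ZMod q) :
    cubicNewvectorChar q (upperGL a d b) = if a = d then (if b = 0 then (q : ℤ) - 1 else -1) else 0 := by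
  unfold cubicNewvectorChar cubicNewvectorCharMat
  obtain ⟨htr, hdet⟩ := trace_det_upperGL a d b
  simp only [h1, if_false]
  rw [htr, hdet]
  have hΔ : ((a : ZMod q) + d) ^ 2 - 4 * ((a : ZMod q) * d) = ((a : ZMod q) - d) ^ 2 := by ring
  rw [hΔ]
  by_cases had : a = d
  · subst had
    simp only [sub_self, ne_eq, OfNat.ofNat_ne_zero, not_false_eq_true, zero_pow, if_true, isScalarMat_upperGL_iff,
      and_true]
  · have hne : ((a : ZMod q) - d) ^ 2 ≠ 0 := by
      intro h
      apply had
      exact Units.ext (sub_eq_zero.1 (pow_eq_zero_iff two_ne_zero |>.1 h))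
    simp only [hne, if_false, hasRatEigenvalue_upperGL, if_true, had]

/-- PROVED — **CUSPIDALITY ON THE BOREL**: for `q % 3 ≠ 1`, `Σ_{g ∈ B} χ_W(g) = 0`
(`Σ_a [(q−1) + (q−1)·(−1)] + Σ_{a≠d} 0`). [folklore] -/
theorem sum_borel_cubicNewvectorChar (h1 : q % 3 ≠ 1) :
    ∑ g ∈ Finset.univ.filter (fun g : G q => (g : Mat q) 1 0 = 0), cubicNewvectorChar q g = 0 := by
  rw [borel_eq_image, Finset.sum_image (fun x _ y _ h => upperGL_injective h)]
  simp only [cubicNewvectorChar_upperGL_cusp h1]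
  rw [Fintype.sum_prod_type, Finset.sum_eq_zero]
  intro a _
  rw [Fintype.sum_prod_type]
  -- Σ_d Σ_b (if a = d then (if b = 0 then q-1 else -1) else 0) = (q - 1) + (q - 1) * (-1)
  rw [Finset.sum_eq_single a (fun d _ hd => by simp [Ne.symm hd]) (fun h => absurd (Finset.mem_univ a) h)]
  simp only [if_true]
  rw [Finset.sum_ite, Finset.sum_const, Finset.sum_const]
  have hc1 : (Finset.univ.filter (fun x : ZMod q => x = 0)).card = 1 := by
    rw [Finset.card_eq_one]
    exact ⟨0, by ext x; simp⟩
  have hc2 : (Finset.univ.filter (fun x : ZMod q => ¬ x = 0)).card = q - 1 := by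
    have h := Finset.card_filter_add_card_filter_not (s := (Finset.univ : Finset (ZMod q))) (fun x : ZMod q => x = 0)
    rw [hc1, Finset.card_univ, ZMod.card] at h
    omega
  rw [hc1, hc2]
  have hq1 : 1 ≤ q := (Fact.out : q.Prime).one_lt.le
  simp only [one_smul, smul_neg, nsmul_eq_mul, Nat.cast_sub hq1, Nat.cast_one, mul_one]
  ring

/-- PROVED: for `q ≡ 2 (mod 3)` the order `q (q−1)²` of the Borel subgroup is prime to `3`. [folklore] -/
theorem isCoprime_card_borel_three (h2 : q % 3 = 2) : IsCoprime ((q * (q - 1) ^ 2 : ℕ) : ℤ) 3 := by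
  have hq1 : 1 ≤ q := (Fact.out : q.Prime).one_lt.le
  rw [show (3 : ℤ) = ((3 : ℕ) : ℤ) by norm_num, Nat.isCoprime_iff_coprime]
  apply Nat.Coprime.mul_left
  · rw [Nat.coprime_comm, Nat.Prime.coprime_iff_not_dvd Nat.prime_three]
    omega
  · apply Nat.Coprime.pow_left
    rw [Nat.coprime_comm, Nat.Prime.coprime_iff_not_dvd Nat.prime_three]
    omega

/-- PROVED — **THE MOD-3 CONDITION IS AUTOMATIC AT CUSPIDAL PRIMES**: for `q ≡ 2 (mod 3)`, any `ℤ`-representation of `GL₂(𝔽_q)` on `ℤ^d` with character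
`cubicNewvectorChar q` has no non-zero `G`-fixed vector mod `3` — the `noFixedVectorModThree` clause of `CartanDegree.CartanTorusLattice` follows from `trace_eq`.
[folklore] -/
theorem noFixedVectorModThree_of_cusp (h2 : q % 3 = 2) {d : ℕ} (ρ : Representation ℤ (G q) (Fin d → ℤ))
    (htr : ∀ g, LinearMap.trace ℤ (Fin d → ℤ) (ρ g) = cubicNewvectorChar q g) :
    ∀ v : Fin d → ℤ, (∀ g, ∃ w : Fin d → ℤ, ρ g v - v = (3 : ℤ) • w) → ∃ w : Fin d → ℤ, v = (3 : ℤ) • w := by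
  intro v hv
  have h1 : q % 3 ≠ 1 := by omega
  -- the character sum over `B` vanishes
  have hsum : ∑ h : borelSub q, LinearMap.trace ℤ (Fin d → ℤ) (ρ (h : G q)) = 0 := by
    simp only [htr]
    have h := sum_borel_cubicNewvectorChar (q := q) h1
    rw [← h, Finset.sum_subtype (Finset.univ.filter (fun g : G q => (g : Mat q) 1 0 = 0))]
    intro g
    simp only [Finset.mem_filter, Finset.mem_univ, true_and]
    exact Iff.rfl
  -- `|B|` is prime to `3`
  have hcard : (Fintype.card (borelSub q) : ℤ) = ((q * (q - 1) ^ 2 : ℕ) : ℤ) := by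
    rw [← card_borelSub (q := q), Nat.card_eq_fintype_card]
  have hcop : IsCoprime (Fintype.card (borelSub q) : ℤ) 3 := by
    rw [hcard]; exact isCoprime_card_borel_three h2
  exact exists_eq_smul_of_fixedMod ρ (borelSub q) hsum 3 hcop v (fun h => hv h)

/-- PROVED — the same packaged on the structure: every `CartanTorusLattice q` at a cuspidal prime satisfies its `noFixedVectorModThree` clause for free (so a
would-be constructor at `q ≡ 2 (3)` may take it from here). [folklore] -/
theorem cartanTorusLattice_noFixed_redundant (h2 : q % 3 = 2) (𝓛 : CartanTorusLattice q) (v : Fin 𝓛.d → ℤ)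
    (hv : ∀ g, ∃ w : Fin 𝓛.d → ℤ, 𝓛.ρ g v - v = (3 : ℤ) • w) : ∃ w : Fin 𝓛.d → ℤ, v = (3 : ℤ) • w :=
  noFixedVectorModThree_of_cusp h2 𝓛.ρ 𝓛.trace_eq v hv

end borel

end Summit.BirchSwinnertonDyer.BirchSwinnertonDyer.Theorems.CartanSupply.CuspNoFixed
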